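import Mathlib

/-!
# Crux `FeketeSOS.CharPSparseSOS` (stmt-ValiantsHypothesis-14989), line `Sketch-ideator5` —
# stub `stub_firstLemmaAssembly`

The real-analysis assembly of the card's First Lemma "`TraceBias(η)` ⇒ robust Shkredov in the
window".  Notation: `χ = legendreSym p`, `Λ_Q(x) = Σ_{a∈Q} χ(x+a)`, `q = #Q`,
`e = #{n < p : r_Q(n) ≠ 1_QR(n)}`, `L = Σ_{x∈Q} Λ_Q(x)`, `M = Σ_{x<p} Λ_Q(x)⁴`,
`D = Σ_{distinct quadruples} S_p`, `r = √p`, `ε = p^{δ−1/2}` (so `p^δ = εr`, `p^{1/2+δ} = εr²`).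

Given, as black boxes, K1 (`q ≥ (1−η)r ⇒ D ≤ (1−η) r q⁴` for `p ≥ p₀`), the window-counting
inequalities (`p − 1 − 2e ≤ q(q−1)` and `2(p−1) − 4e − q² ≤ L`) and the fourth-moment bound
(`M ≤ D + 16 p q²`), we show: for `p` large, `q ≤ r + εr` forces `εr² ≤ 3q + 2e + 13r + 13`.

Proof (by contradiction, `3q + 2e + 13r + 13 < εr²`, whence `2e < εr²`).
* Step 1 (coverage): `q² ≥ q(q−1) ≥ r² − 1 − 2e > r²(1−ε) − 1`, so `q ≥ (1−η)r` once `ε ≤ η/2`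
  and `ηr² ≥ 4`; hence K1 applies.
* Step 2 (first moment): `L ≥ 2(r²−1) − 4e − q² > r² − 5εr² − 2 =: A > 0`.
* Step 3 (power mean on `Q ⊆ [0,p)`): `L⁴ ≤ (Σ_{x∈Q}|Λ_Q|)⁴ ≤ q³ Σ_{x∈Q} Λ_Q⁴ ≤ q³ M`.
* Step 4: `A⁴ ≤ L⁴ ≤ q³M ≤ (1−η) r q⁷ + 16 r² q⁵ ≤ (1−η)(1+127ε) r⁸ + 512 r⁷` (using
  `q ≤ (1+ε)r`, `(1+ε)⁷ ≤ 1 + 127ε`, `(1+ε)⁵ ≤ 32`), while `A⁴ ≥ r⁸ − 20εr⁸ − 8r⁶`; with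
  `ε ≤ η/400` this gives `ηr ≤ 823`, contradicting `ηr ≥ 1040`.
The thresholds `ε ≤ η/400` and `√p ≥ 1040/η` hold for
`p ≥ ⌈(400/η)^{1/(1/2−δ)}⌉₊ + ⌈(1040/η)²⌉₊`.
-/

-- `Summit.ValiantsHypothesis.ValiantsHypothesis.…` is the tree's mandated single-conjunct layout (Sub = Summit).
set_option linter.dupNamespace false

namespace Summit.ValiantsHypothesis.ValiantsHypothesis.Theorems.CharPSparseSOSTraceBias

open Finset

/-! ## Elementary real inequalities -/

/-- `(1+ε)⁷ ≤ 1 + 127ε` for `0 ≤ ε ≤ 1` (expand and use `εᵏ ≤ ε`). -/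
theorem fa_pow_seven_le (ε : ℝ) (h0 : 0 ≤ ε) (h1 : ε ≤ 1) : (1 + ε) ^ 7 ≤ 1 + 127 * ε := by
  have h2 : ε ^ 2 ≤ ε := pow_le_of_le_one h0 h1 two_ne_zero
  have h3 : ε ^ 3 ≤ ε := pow_le_of_le_one h0 h1 (by norm_num)
  have h4 : ε ^ 4 ≤ ε := pow_le_of_le_one h0 h1 (by norm_num)
  have h5 : ε ^ 5 ≤ ε := pow_le_of_le_one h0 h1 (by norm_num)
  have h6 : ε ^ 6 ≤ ε := pow_le_of_le_one h0 h1 (by norm_num)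
  have h7 : ε ^ 7 ≤ ε := pow_le_of_le_one h0 h1 (by norm_num)
  have hexp : (1 + ε) ^ 7 =
      1 + 7 * ε + 21 * ε ^ 2 + 35 * ε ^ 3 + 35 * ε ^ 4 + 21 * ε ^ 5 + 7 * ε ^ 6 + ε ^ 7 := by
    ring
  linarith

/-- The quartic lower bound `r⁸ − 20εr⁸ − 8r⁶ ≤ (r² − 5εr² − 2)⁴`: with `R = r²`, `c = 5εr² + 2`
the difference `(R − c)⁴ − (R⁴ − 4R³c)` equals `c²(2R² + (2R − c)²) ≥ 0`. -/
theorem fa_quartic_lower (r ε : ℝ) :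
    r ^ 8 - 20 * ε * r ^ 8 - 8 * r ^ 6 ≤ (r ^ 2 - 5 * ε * r ^ 2 - 2) ^ 4 := by
  have key : (r ^ 2 - 5 * ε * r ^ 2 - 2) ^ 4 - (r ^ 8 - 20 * ε * r ^ 8 - 8 * r ^ 6) =
      (5 * ε * r ^ 2 + 2) ^ 2 * (2 * (r ^ 2) ^ 2 + (2 * r ^ 2 - (5 * ε * r ^ 2 + 2)) ^ 2) := by
    ring
  have h0 : 0 ≤ (5 * ε * r ^ 2 + 2) ^ 2 * (2 * (r ^ 2) ^ 2 + (2 * r ^ 2 - (5 * ε * r ^ 2 + 2)) ^ 2) := by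
    positivity
  linarith

/-- Step 1 (coverage ⇒ K1 applies): from `r² − 1 − 2e ≤ q(q−1)`, `2e < εr²`, `ε ≤ η/2` and
`ηr² ≥ 4` we get `q ≥ (1−η)r`. -/
theorem fa_card_lower (η ε r q e : ℝ) (hη : 0 < η) (hη1 : η < 1) (hε : ε ≤ η / 2)
    (hr : 4 ≤ η * r ^ 2) (hq : 0 ≤ q) (he : 2 * e < ε * r ^ 2)
    (hWC1 : r ^ 2 - 1 - 2 * e ≤ q * (q - 1)) : (1 - η) * r ≤ q := by
  by_contra hlt
  have hlt := not_le.mp hlt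
  have h1 : q * q < (1 - η) * r * ((1 - η) * r) := mul_self_lt_mul_self hq hlt
  have h2 : ε * r ^ 2 ≤ η / 2 * r ^ 2 := mul_le_mul_of_nonneg_right hε (sq_nonneg r)
  have h3 : η * (η * r ^ 2) ≤ 1 * (η * r ^ 2) :=
    mul_le_mul_of_nonneg_right hη1.le (mul_nonneg hη.le (sq_nonneg r))
  linarith

/-- Step 2 (first moment): from `2(r²−1) − 4e − q² ≤ L`, `2e < εr²` and `0 ≤ q ≤ r + εr` we get
`L > r² − 5εr² − 2`. -/
theorem fa_first_moment (ε r q e L : ℝ) (hε0 : 0 ≤ ε) (hε1 : ε ≤ 1) (hq : 0 ≤ q)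
    (hwin : q ≤ r + ε * r) (he : 2 * e < ε * r ^ 2)
    (hWC2 : 2 * (r ^ 2 - 1) - 4 * e - q ^ 2 ≤ L) : r ^ 2 - 5 * ε * r ^ 2 - 2 < L := by
  have h1 : q ^ 2 ≤ (r + ε * r) ^ 2 := pow_le_pow_left₀ hq hwin 2
  have h2 : ε ^ 2 * r ^ 2 ≤ ε * r ^ 2 :=
    mul_le_mul_of_nonneg_right (pow_le_of_le_one hε0 hε1 two_ne_zero) (sq_nonneg r)
  linarith

/-- Steps 3–4 (power mean, fourth moment, K1): the bounds `A⁴ ≤ L⁴ ≤ q³M`,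
`M ≤ D + 16r²q²`, `D ≤ (1−η) r q⁴`, `q ≤ (1+ε) r` with `A = r² − 5εr² − 2` are incompatible
once `ε ≤ η/400` and `ηr ≥ 1040`. -/
theorem fa_contradiction (η ε r q L M D : ℝ) (hη : 0 < η) (hη1 : η < 1) (hε0 : 0 ≤ ε)
    (hε : ε ≤ η / 400) (hr1 : 1040 ≤ r) (hηr : 1040 ≤ η * r) (hq0 : 0 ≤ q)
    (hwin : q ≤ r + ε * r) (hL : r ^ 2 - 5 * ε * r ^ 2 - 2 < L)
    (hPM : 0 ≤ L → L ^ 4 ≤ q ^ 3 * M) (hM4 : M ≤ D + 16 * r ^ 2 * q ^ 2)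
    (hD : D ≤ (1 - η) * r * q ^ 4) : False := by
  have hr0 : 0 ≤ r := by linarith
  have hε1 : ε ≤ 1 := by linarith
  set A := r ^ 2 - 5 * ε * r ^ 2 - 2 with hA
  have hεr : ε * r ^ 2 ≤ 1 / 400 * r ^ 2 := mul_le_mul_of_nonneg_right (by linarith) (sq_nonneg r)
  have hr2 : (1040 : ℝ) * 1040 ≤ r * r := mul_le_mul hr1 hr1 (by norm_num) hr0
  have hA0 : 0 ≤ A := by rw [hA]; linarith
  have hL0 : 0 ≤ L := by linarith
  have h1 : A ^ 4 ≤ L ^ 4 := pow_le_pow_left₀ hA0 hL.le 4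
  have h2 : L ^ 4 ≤ q ^ 3 * M := hPM hL0
  have h3 : q ^ 3 * M ≤ q ^ 3 * ((1 - η) * r * q ^ 4 + 16 * r ^ 2 * q ^ 2) :=
    mul_le_mul_of_nonneg_left (by linarith) (pow_nonneg hq0 3)
  have h4 : q ^ 7 ≤ r ^ 7 * (1 + 127 * ε) :=
    calc q ^ 7 ≤ (r + ε * r) ^ 7 := pow_le_pow_left₀ hq0 hwin 7
      _ = r ^ 7 * (1 + ε) ^ 7 := by ring
      _ ≤ r ^ 7 * (1 + 127 * ε) :=
        mul_le_mul_of_nonneg_left (fa_pow_seven_le ε hε0 hε1) (pow_nonneg hr0 7)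
  have h5 : q ^ 5 ≤ 32 * r ^ 5 :=
    calc q ^ 5 ≤ (r + ε * r) ^ 5 := pow_le_pow_left₀ hq0 hwin 5
      _ = r ^ 5 * (1 + ε) ^ 5 := by ring
      _ ≤ r ^ 5 * 2 ^ 5 :=
        mul_le_mul_of_nonneg_left (pow_le_pow_left₀ (by linarith) (by linarith) 5)
          (pow_nonneg hr0 5)
      _ = 32 * r ^ 5 := by ring
  have h6 : (1 - η) * r * q ^ 7 ≤ (1 - η) * r * (r ^ 7 * (1 + 127 * ε)) :=
    mul_le_mul_of_nonneg_left h4 (mul_nonneg (by linarith) hr0)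
  have h7 : 16 * r ^ 2 * q ^ 5 ≤ 16 * r ^ 2 * (32 * r ^ 5) :=
    mul_le_mul_of_nonneg_left h5 (by positivity)
  have h8 : r ^ 8 - 20 * ε * r ^ 8 - 8 * r ^ 6 ≤ A ^ 4 := by rw [hA]; exact fa_quartic_lower r ε
  have h9 : ε * r ^ 8 ≤ η / 400 * r ^ 8 := mul_le_mul_of_nonneg_right hε (by positivity)
  have h10 : 1040 * r ^ 7 ≤ η * r * r ^ 7 := mul_le_mul_of_nonneg_right hηr (by positivity)
  have h11 : r ^ 6 ≤ r ^ 7 := pow_le_pow_right₀ (by linarith) (by norm_num)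
  have h12 : 0 ≤ ε * η * r ^ 8 := by positivity
  have h13 : (0 : ℝ) < r ^ 7 := by positivity
  linarith

/-- Casting the integer hypotheses to `ℝ` and running Steps 0–4 at a fixed prime:
here `qn = #Q`, `en = #Err`, `Lz = Σ_{x∈Q} Λ_Q(x)`, `Mz = Σ_{x<p} Λ_Q(x)⁴`, `Dz = Σ_{distinct} S_p`. -/
theorem fa_final (η ε r : ℝ) (p qn en : ℕ) (Lz Mz Dz : ℤ)
    (hη : 0 < η) (hη1 : η < 1) (hε0 : 0 ≤ ε) (hε : ε ≤ η / 400) (hr0 : 0 ≤ r)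
    (hηr : 1040 ≤ η * r) (hpr : (p : ℝ) = r ^ 2)
    (hcov : (p : ℤ) - 1 - 2 * (en : ℤ) ≤ (qn : ℤ) * ((qn : ℤ) - 1))
    (hfm : 2 * ((p : ℤ) - 1) - 4 * (en : ℤ) - (qn : ℤ) ^ 2 ≤ Lz)
    (hM4 : Mz ≤ Dz + 16 * (p : ℤ) * (qn : ℤ) ^ 2)
    (hK1 : (1 - η) * r ≤ (qn : ℝ) → (Dz : ℝ) ≤ (1 - η) * r * (qn : ℝ) ^ 4)
    (hPM : 0 ≤ Lz → Lz ^ 4 ≤ (qn : ℤ) ^ 3 * Mz)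
    (hwin : (qn : ℝ) ≤ r + ε * r)
    (hcon : 3 * (qn : ℝ) + 2 * (en : ℝ) + 13 * r + 13 < ε * r ^ 2) : False := by
  have hq0 : (0 : ℝ) ≤ qn := Nat.cast_nonneg _
  have he0 : (0 : ℝ) ≤ en := Nat.cast_nonneg _
  have hcovR : (p : ℝ) - 1 - 2 * (en : ℝ) ≤ (qn : ℝ) * ((qn : ℝ) - 1) := by
    have h := (Int.cast_le (R := ℝ)).mpr hcov
    push_cast at h
    exact h
  have hfmR : 2 * ((p : ℝ) - 1) - 4 * (en : ℝ) - (qn : ℝ) ^ 2 ≤ (Lz : ℝ) := by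
    have h := (Int.cast_le (R := ℝ)).mpr hfm
    push_cast at h
    exact h
  have hM4R : (Mz : ℝ) ≤ (Dz : ℝ) + 16 * (p : ℝ) * (qn : ℝ) ^ 2 := by
    have h := (Int.cast_le (R := ℝ)).mpr hM4
    push_cast at h
    exact h
  have hPMR : (0 : ℝ) ≤ (Lz : ℝ) → (Lz : ℝ) ^ 4 ≤ (qn : ℝ) ^ 3 * (Mz : ℝ) := by
    intro h
    have h0 : (0 : ℤ) ≤ Lz := by exact_mod_cast h
    have h1 := (Int.cast_le (R := ℝ)).mpr (hPM h0)
    push_cast at h1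
    exact h1
  rw [hpr] at hcovR hfmR hM4R
  -- Step 0: sizes
  have hr1 : 1040 ≤ r := le_trans hηr (mul_le_of_le_one_left hr0 hη1.le)
  have he : 2 * (en : ℝ) < ε * r ^ 2 := by linarith
  have hεη : ε ≤ η / 2 := by linarith
  have hε1 : ε ≤ 1 := by linarith
  have hηr2 : 4 ≤ η * r ^ 2 := by
    have : 1040 * 1040 ≤ η * r * r := mul_le_mul hηr hr1 (by norm_num) (mul_nonneg hη.le hr0)
    linarith
  -- Steps 1–4
  have hq1 : (1 - η) * r ≤ qn := fa_card_lower η ε r qn en hη hη1 hεη hηr2 hq0 he hcovR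
  exact fa_contradiction η ε r qn Lz Mz Dz hη hη1 hε0 hε hr1 hηr hq0 hwin
    (fa_first_moment ε r qn en Lz hε0 hε1 hq0 hwin he hfmR) hPMR hM4R (hK1 hq1)

/-! ## The power mean on `Q` -/

/-- Power mean (Step 3): for `s ⊆ t` and `Σ_{x∈s} f ≥ 0`,
`(Σ_{x∈s} f)⁴ ≤ (Σ_{x∈s} |f|)⁴ ≤ #s³ Σ_{x∈s} f⁴ ≤ #s³ Σ_{x∈t} f⁴`. -/
theorem fa_powerMean {s t : Finset ℕ} (hst : s ⊆ t) (f : ℕ → ℤ) (hL : 0 ≤ ∑ x ∈ s, f x) :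
    (∑ x ∈ s, f x) ^ 4 ≤ (s.card : ℤ) ^ 3 * ∑ x ∈ t, f x ^ 4 := by
  have h1 : ∑ x ∈ s, f x ≤ ∑ x ∈ s, |f x| := sum_le_sum fun i _ => le_abs_self _
  have h2 : (∑ x ∈ s, |f x|) ^ 4 ≤ (s.card : ℤ) ^ 3 * ∑ x ∈ s, |f x| ^ 4 :=
    pow_sum_le_card_mul_sum_pow (fun i _ => abs_nonneg _) 3
  have h3 : ∑ x ∈ s, |f x| ^ 4 = ∑ x ∈ s, f x ^ 4 :=
    sum_congr rfl fun i _ => Even.pow_abs (by decide) _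
  have h4 : ∑ x ∈ s, f x ^ 4 ≤ ∑ x ∈ t, f x ^ 4 :=
    sum_le_sum_of_subset_of_nonneg hst fun i _ _ => by positivity
  calc (∑ x ∈ s, f x) ^ 4 ≤ (∑ x ∈ s, |f x|) ^ 4 := pow_le_pow_left₀ hL h1 4
    _ ≤ (s.card : ℤ) ^ 3 * ∑ x ∈ s, f x ^ 4 := h3 ▸ h2
    _ ≤ (s.card : ℤ) ^ 3 * ∑ x ∈ t, f x ^ 4 := mul_le_mul_of_nonneg_left h4 (by positivity)

/-! ## The registered stub -/

/-- **Stub 7 (first-lemma assembly, elementary real analysis).**  Fix `0 < η < 1` and `0 < δ < 1/2`.  Assume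
K1 with this `η`, the window-counting inequalities of Stub 3, and the fourth-moment bound
`Σ_{x<p} Λ_Q⁴ ≤ Σ_{distinct} S_p + 16 p #Q²`.  Then for all large primes `p`, every `Q ⊆ [0,p)` in the window
`#Q ≤ √p + p^δ` satisfies `p^{1/2+δ} ≤ 3#Q + 2#Err + 13√p + 13`.  (If not: `#Err < p^{1/2+δ}/2`, coverage gives
`#Q ≥ (1−η)√p`, the first moment gives `Σ_{x∈Q}Λ_Q > p − 5p^{1/2+δ} − 2`, the power mean on `Q` gives
`Σ_x Λ_Q⁴ ≥ (Σ_{x∈Q}Λ_Q)⁴/#Q³`, and then `Σ_{distinct} S_p ≥ (1 − o(1))√p·#Q⁴`, contradicting K1; the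
threshold is `p ≥ max(p₀, 3, ⌈(400/η)^{1/(1/2−δ)}⌉₊ + ⌈(1040/η)²⌉₊)`.) -/
theorem stub_firstLemmaAssembly :
    ∀ η δ : ℝ, 0 < η → η < 1 → 0 < δ → δ < 1 / 2 →
      (∃ p₀ : ℕ, ∀ (p : ℕ) [Fact p.Prime], p₀ ≤ p → ∀ Q : Finset ℕ, (∀ a ∈ Q, a < p) →
        (1 - η) * Real.sqrt p ≤ (Q.card : ℝ) →
        (∑ t ∈ ((Q ×ˢ Q) ×ˢ (Q ×ˢ Q)).filter (fun t : (ℕ × ℕ) × (ℕ × ℕ) =>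
            t.1.1 ≠ t.1.2 ∧ t.1.1 ≠ t.2.1 ∧ t.1.1 ≠ t.2.2 ∧ t.1.2 ≠ t.2.1 ∧ t.1.2 ≠ t.2.2 ∧ t.2.1 ≠ t.2.2),
          ((∑ x ∈ range p, legendreSym p
            (((x : ℤ) + t.1.1) * ((x : ℤ) + t.1.2) * ((x : ℤ) + t.2.1) * ((x : ℤ) + t.2.2)) : ℤ) : ℝ)) ≤
        (1 - η) * Real.sqrt p * (Q.card : ℝ) ^ 4) →
      (∀ (p : ℕ) [Fact p.Prime], p ≠ 2 → ∀ Q : Finset ℕ, (∀ a ∈ Q, a < p) →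
        ((p : ℤ) - 1 - 2 * (((range p).filter (fun n => ((Q ×ˢ Q).filter
                (fun ab : ℕ × ℕ => ab.1 < ab.2 ∧ (ab.1 + ab.2) % p = n)).card ≠
                  (if n ≠ 0 ∧ legendreSym p n = 1 then 1 else 0))).card : ℤ) ≤
            (Q.card : ℤ) * ((Q.card : ℤ) - 1)) ∧
        (2 * ((p : ℤ) - 1) - 4 * (((range p).filter (fun n => ((Q ×ˢ Q).filter
                (fun ab : ℕ × ℕ => ab.1 < ab.2 ∧ (ab.1 + ab.2) % p = n)).card ≠
                  (if n ≠ 0 ∧ legendreSym p n = 1 then 1 else 0))).card : ℤ) - (Q.card : ℤ) ^ 2 ≤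
            ∑ x ∈ Q, ∑ a ∈ Q, legendreSym p ((x : ℤ) + a))) →
      (∀ (p : ℕ) [Fact p.Prime], p ≠ 2 → ∀ Q : Finset ℕ, (∀ a ∈ Q, a < p) →
        (∑ x ∈ range p, (∑ a ∈ Q, legendreSym p ((x : ℤ) + a)) ^ 4) ≤
          (∑ t ∈ ((Q ×ˢ Q) ×ˢ (Q ×ˢ Q)).filter (fun t : (ℕ × ℕ) × (ℕ × ℕ) =>
              t.1.1 ≠ t.1.2 ∧ t.1.1 ≠ t.2.1 ∧ t.1.1 ≠ t.2.2 ∧ t.1.2 ≠ t.2.1 ∧ t.1.2 ≠ t.2.2 ∧ t.2.1 ≠ t.2.2),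
            ∑ x ∈ range p, legendreSym p
              (((x : ℤ) + t.1.1) * ((x : ℤ) + t.1.2) * ((x : ℤ) + t.2.1) * ((x : ℤ) + t.2.2))) +
          16 * (p : ℤ) * (Q.card : ℤ) ^ 2) →
      ∃ p₁ : ℕ, ∀ (p : ℕ) [Fact p.Prime], p₁ ≤ p → ∀ Q : Finset ℕ, (∀ a ∈ Q, a < p) →
        (Q.card : ℝ) ≤ Real.sqrt p + (p : ℝ) ^ δ →
        (p : ℝ) ^ (1 / 2 + δ) ≤ 3 * (Q.card : ℝ) +
          2 * (((range p).filter (fun n => ((Q ×ˢ Q).filter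
              (fun ab : ℕ × ℕ => ab.1 < ab.2 ∧ (ab.1 + ab.2) % p = n)).card ≠
                (if n ≠ 0 ∧ legendreSym p n = 1 then 1 else 0))).card : ℝ) +
          13 * Real.sqrt p + 13 := by
  intro η δ hη hη1 _hδ hδ2 hK1 hWC hM4
  obtain ⟨p₀, hK⟩ := hK1
  have hgap : (0 : ℝ) < 1 / 2 - δ := by linarith
  refine ⟨max p₀ (max 3 (⌈((400 : ℝ) / η) ^ (1 / (1 / 2 - δ))⌉₊ + ⌈((1040 : ℝ) / η) ^ 2⌉₊)), ?_⟩
  intro p _ hp Q hQ hwin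
  have hp₀ : p₀ ≤ p := le_of_max_le_left hp
  have hp3 : 3 ≤ p := le_of_max_le_left (le_of_max_le_right hp)
  have hN : ⌈((400 : ℝ) / η) ^ (1 / (1 / 2 - δ))⌉₊ + ⌈((1040 : ℝ) / η) ^ 2⌉₊ ≤ p :=
    le_of_max_le_right (le_of_max_le_right hp)
  have hp2 : p ≠ 2 := by omega
  have hp0 : (0 : ℝ) < (p : ℝ) := by exact_mod_cast (show 0 < p by omega)
  -- thresholds: `400/η ≤ p^(1/2-δ)` and `1040/η ≤ √p`
  have hNR : (⌈((400 : ℝ) / η) ^ (1 / (1 / 2 - δ))⌉₊ : ℝ) + (⌈((1040 : ℝ) / η) ^ 2⌉₊ : ℝ) ≤ (p : ℝ) := by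
    exact_mod_cast hN
  have hc1 := Nat.le_ceil (((400 : ℝ) / η) ^ (1 / (1 / 2 - δ)))
  have hc2 := Nat.le_ceil (((1040 : ℝ) / η) ^ 2)
  have hc1' : (0 : ℝ) ≤ (⌈((400 : ℝ) / η) ^ (1 / (1 / 2 - δ))⌉₊ : ℝ) := Nat.cast_nonneg _
  have hc2' : (0 : ℝ) ≤ (⌈((1040 : ℝ) / η) ^ 2⌉₊ : ℝ) := Nat.cast_nonneg _
  have h400pos : (0 : ℝ) < 400 / η := by positivity
  have h400 : (400 : ℝ) / η ≤ (p : ℝ) ^ (1 / 2 - δ) := by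
    have h1 : ((400 : ℝ) / η) ^ (1 / (1 / 2 - δ)) ≤ (p : ℝ) := by linarith
    have h2 : (((400 : ℝ) / η) ^ (1 / (1 / 2 - δ))) ^ (1 / 2 - δ) ≤ (p : ℝ) ^ (1 / 2 - δ) :=
      Real.rpow_le_rpow (Real.rpow_nonneg h400pos.le _) h1 hgap.le
    rwa [← Real.rpow_mul h400pos.le, one_div_mul_cancel hgap.ne', Real.rpow_one] at h2
  have hr_ge : (1040 : ℝ) / η ≤ Real.sqrt p := Real.le_sqrt_of_sq_le (by linarith)
  -- the real parameters `r = √p`, `ε = p^(δ-1/2)`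
  have h_half : (p : ℝ) ^ (1 / 2 : ℝ) = Real.sqrt p := (Real.sqrt_eq_rpow _).symm
  have hpδ : (p : ℝ) ^ δ = (p : ℝ) ^ (δ - 1 / 2) * Real.sqrt p := by
    rw [← h_half, ← Real.rpow_add hp0, sub_add_cancel]
  have hP : (p : ℝ) ^ (1 / 2 + δ) = (p : ℝ) ^ (δ - 1 / 2) * Real.sqrt p ^ 2 := by
    rw [Real.rpow_add hp0, h_half, hpδ]; ring
  have hεle : (p : ℝ) ^ (δ - 1 / 2) ≤ η / 400 := by
    rw [show (δ - 1 / 2 : ℝ) = -(1 / 2 - δ) by ring, Real.rpow_neg hp0.le]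
    calc ((p : ℝ) ^ (1 / 2 - δ))⁻¹ ≤ (400 / η)⁻¹ := inv_anti₀ h400pos h400
      _ = η / 400 := inv_div _ _
  have hε0 : (0 : ℝ) ≤ (p : ℝ) ^ (δ - 1 / 2) := Real.rpow_nonneg hp0.le _
  have hr0 : (0 : ℝ) ≤ Real.sqrt p := Real.sqrt_nonneg _
  have hpr : (p : ℝ) = Real.sqrt p ^ 2 := (Real.sq_sqrt hp0.le).symm
  have hηne : η ≠ 0 := hη.ne'
  have hηr : 1040 ≤ η * Real.sqrt p :=
    calc (1040 : ℝ) = η * (1040 / η) := by field_simp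
      _ ≤ η * Real.sqrt p := mul_le_mul_of_nonneg_left hr_ge hη.le
  -- the hypotheses at `(p, Q)`
  obtain ⟨hcov, hfm⟩ := hWC p hp2 Q hQ
  have hM := hM4 p hp2 Q hQ
  have hKQ := hK p hp₀ Q hQ
  rw [← Int.cast_sum] at hKQ
  have hsub : Q ⊆ range p := fun x hx => mem_range.mpr (hQ x hx)
  have hPM := fa_powerMean hsub (fun x => ∑ a ∈ Q, legendreSym p ((x : ℤ) + a))
  -- suppose the conclusion fails
  by_contra hcon
  have hcon := not_le.mp hcon
  rw [hP] at hcon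
  rw [hpδ] at hwin
  exact fa_final η ((p : ℝ) ^ (δ - 1 / 2)) (Real.sqrt p) p _ _ _ _ _ hη hη1 hε0 hεle hr0 hηr hpr
    hcov hfm hM hKQ hPM hwin hcon

end Summit.ValiantsHypothesis.ValiantsHypothesis.Theorems.CharPSparseSOSTraceBias
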